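import Summits.BirchSwinnertonDyer.BirchSwinnertonDyer.Theses.PrintX9
import Summits.BirchSwinnertonDyer.BirchSwinnertonDyer.Theorems.Rank1ResidualX9CMPartner
import Literature.NumberTheory.EllipticCurves.Rank1Residual.ClassX1KellerYinCertificate
import HarnessLib

/-!
# Route PrintX9: the W-ALL/9 corner `WAllCornerX9` IS the K6 leaf `Rank1Residual.BSDpOnClassX9`
# (corner ⟹ leaf bridge; cell `bsd-print-x9`, seat p2; director-bsd 2026-08-27T13:52Z, referee REF-18)

HONEST FRAMING. Route `PrintX9` (`Theses/PrintX9.lean`) closes the W-ALL/9 corner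
`Summit.BirchSwinnertonDyer.WAllCornerX9` (`WAll/Target.lean`: for every globally minimal `W` and
prime `p`, `Literature…Rank1Residual.ClassX9 W p → W.analyticRank ≤ 1 → BSDp W p`, where the
Literature census predicate `ClassX9` carries the rank-one clause `r = 1 → ¬ Semistable W`), while
the cell's LEAF of record for D-0131 counting is the K6 class statement
`Summit.BirchSwinnertonDyer.BirchSwinnertonDyer.Rank1Residual.BSDpOnClassX9`
(`Theorems/Rank1ResidualX9Defs.lean`: `W.analyticRank ≤ 1 → ClassX9 W p → Finite W.sha →
PPartBSD W p`, with the Summits-side `ClassX9` = ¬cm ∧ `p ≥ 5` ∧ good ∧ ordinary ∧ irr ∧ ¬surj and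
NO semistability clause). The tree had leaf ⟹ corner (`WAll.wallCornerX9_of_bsdpOnClassX9`) but
not corner ⟹ leaf (referee REF-18, director's currency word 13:52Z asking for the bridge
`bsdpOnClassX9_of_wallCornerX9`). Seat p1 landed that bridge in the referee's recipe shape
(`Theorems/PrintX9BSDpOnClassX9OfWAllCorner.lean`, p538235) WITH a Jetchev–Skinner–Wan 2017
Thm. 1.2.1 binder `hJSW` for the «semistable rank-one X9 pairs»; this file removes that binder.

THE GAP IS EMPTY, so no Jetchev–Skinner–Wan input is needed: an X9 pair has `E[p]` irreducible and
`ρ̄_{E,p}` NOT surjective, and a semistable curve with irreducible `E[p]` has surjective `ρ̄_{E,p}`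
(Serre 1972 §5.4 Prop. 21 i), tree theorem
`hasSurjectiveModNGaloisRep_of_hasIrreducibleModPGaloisRep_of_isSemistable`), so NO X9 pair is
semistable in either rank (`Rank1Residual.ClassX9.not_semistable`, `classX9_iff`; the two class
predicates are equivalent: `classX9_of_classX9_census` / `classX9_census_of_classX9`). Hence the
corner and the leaf are EQUIVALENT granted only the two published binders that convert Miller's
`BSDp` into the print shape `PPartBSD` (`Rank1Residual.pPart_of_bsdp`): the entire continuation of
`L(E,s)` (`hmod`, modularity) and rank = analytic rank ≤ 1 with `Ш` finite (`hGZK`,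
Gross–Zagier–Kolyvagin) — the same two binders the existing direction already carries.

Consequence recorded in §2: the route's deciding theorem `Theses.PrintX9.closes` composed with the
JSW-free bridge concludes the K6 leaf `BSDpOnClassX9` BY NAME from the route's six items ALONE
(`hmod`, `hGZK` are the last two conjuncts of the item `PublishedInputsX9`). Theorems only; nothing
asserted; no new definition, no named fact. beyond-print theorem: no (bookkeeping).
-/

noncomputable section

open scoped Classical

open WeierstrassCurve Literature.NumberTheory.EllipticCurves
  Literature.NumberTheory.EllipticCurves.Rank1Residual

set_option linter.dupNamespace false

set_option autoImplicit false

namespace Summit.BirchSwinnertonDyer.BirchSwinnertonDyer.Rank1Residual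

open Summit.BirchSwinnertonDyer (WAllCornerX9)

/-! ## §1 Corner ⟺ leaf, with NO Jetchev–Skinner–Wan binder -/

/-- **Corner ⟹ leaf, JSW-free (director-bsd 13:52Z / REF-18).** The W-ALL/9 corner `WAllCornerX9`
(`BSDp` on the Literature census class `ClassX9`, rank `≤ 1`) implies the K6 leaf
`Rank1Residual.BSDpOnClassX9` (print shape `PPartBSD` on the Summits-side `ClassX9`), granted ONLY
modularity (`hmod`) and Gross–Zagier–Kolyvagin (`hGZK`). No semistable case split and no JSW 2017
Thm. 1.2.1 (contrast `bsdpOnClassX9_of_wallCornerX9`, p538235): the Summits-side class predicate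
implies the census one outright (`classX9_census_of_classX9` — irr ∧ ¬surj ⟹ ¬semistable, Serre 1972
Prop. 21), and `BSDp ⟹ PPart ⟺ PPartBSD` (`Rank1Residual.pPart_of_bsdp`, `pPartBSD_iff_pPart`).
[folklore] -/
theorem bsdpOnClassX9_of_wallCornerX9_jswFree (hmod : hasEntireLFunction_rat)
    (hGZK : rank_eq_analyticRank_of_analyticRank_le_one) (h : WAllCornerX9) : BSDpOnClassX9 := by
  intro W _ _ p _ hr hX _
  exact (pPartBSD_iff_pPart W p).mpr
    (pPart_of_bsdp hmod hGZK W p hr (h W p (classX9_census_of_classX9 W p hX) hr))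

/-- **Corner ⟺ leaf**: granted modularity and GZK, the W-ALL/9 corner `WAllCornerX9` and the K6
leaf `Rank1Residual.BSDpOnClassX9` are the same statement (converse = the landed
`bsdp_of_bsdpOnClassX9` / `WAll.wallCornerX9_of_bsdpOnClassX9`). [folklore] -/
theorem wallCornerX9_iff_bsdpOnClassX9 (hmod : hasEntireLFunction_rat)
    (hGZK : rank_eq_analyticRank_of_analyticRank_le_one) : WAllCornerX9 ↔ BSDpOnClassX9 :=
  ⟨bsdpOnClassX9_of_wallCornerX9_jswFree hmod hGZK,
    fun h W _ _ p _ hX hr ↦ bsdp_of_bsdpOnClassX9 hmod hGZK h W p hr hX⟩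

/-! ## §2 The route's deciding theorem reaches the leaf BY NAME -/

/-- **Route PrintX9 closes the K6 leaf.** The six items of route `PrintX9` — `Assembly` (20394),
`HeegnerDivisibilityX9` (20392), `AnalyticMuZeroX9` (19630), `SchneiderX9RankOne` (19631),
`HeegnerPrintFactsX9` (20393), `PublishedInputsX9` (19632) — give the corner by the route's
deciding theorem `Theses.PrintX9.closes`, hence the leaf `Rank1Residual.BSDpOnClassX9` by
`bsdpOnClassX9_of_wallCornerX9_jswFree`; `hmod` and `hGZK` are the last two conjuncts of
`PublishedInputsX9`, so no binder beyond the items is needed (in particular no JSW 2017 Thm. 1.2.1).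
[folklore] -/
theorem bsdpOnClassX9_of_printX9_items (hAsm : Theses.PrintX9.Assembly)
    (hJ : Theses.PrintX9.HeegnerDivisibilityX9) (hμ : Theses.PrintX9.AnalyticMuZeroX9)
    (hS : Theses.PrintX9.SchneiderX9RankOne) (hHP : Theses.PrintX9.HeegnerPrintFactsX9)
    (hP : Theses.PrintX9.PublishedInputsX9) : BSDpOnClassX9 :=
  bsdpOnClassX9_of_wallCornerX9_jswFree hP.2.2.2.2.2.2.1 hP.2.2.2.2.2.2.2
    (Theses.PrintX9.closes hAsm hJ hμ hS hHP hP)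

end Summit.BirchSwinnertonDyer.BirchSwinnertonDyer.Rank1Residual
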